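import Mathlib.Analysis.Calculus.BumpFunction.FiniteDimension
import Mathlib.Analysis.SpecialFunctions.Trigonometric.Bounds
import Literature.Analysis.FluidPDE.BradshawFarhatGrujic2019ComponentSparseness
import Literature.Analysis.FluidPDE.VorticityCalculus
import Literature.Analysis.FluidPDE.LerayHopfProofs
import Literature.Analysis.FunctionSpaces.TestPairingLimits
import HarnessLib

/-!
# Bradshaw–Farhat–Grujić 2019, Theorem 26: the a-priori 3D sparseness of the vorticity component
# super-level sets at scale `‖ω‖_∞^{-2/5}` — DISCHARGE of
# `bradshawFarhatGrujic2019_apriori_componentSparseness`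

Topic `Analysis/FluidPDE`. Proof-only companion of
`BradshawFarhatGrujic2019ComponentSparseness.lean`: the named fact
`Literature.Analysis.FluidPDE.bradshawFarhatGrujic2019_apriori_componentSparseness` (Bradshaw–
Farhat–Grujić, Arch. Ration. Mech. Anal. **231** (2019) 1983–2005 = arXiv:1704.05546, **Theorem 26**,
pp. 11–12 of the arXiv version, read from the held text `paper:arxiv-1704.05546`, §4) is PROVED here,
`bradshawFarhatGrujic2019_apriori_componentSparseness_holds`. No new definition, no new named fact.

## The printed proof (§4, Lemma 24 and Theorem 26) and how it is followed

**Lemma 24** (duality): for `r ∈ (0, 1]`, `f` bounded continuous, `λ ∈ (0,1)`, `δ ∈ (1/(1+λ), 1)`,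
if `‖f‖_{H⁻¹} ≤ c*(λ, δ) r^{5/2} ‖f‖_∞` then each `S^{i,±}_λ = {f_i^± > λ‖f‖_∞}` is `r`-semi-mixed with
ratio `δ`. Printed proof: assume `m³(S^{i,+}_λ ∩ B(x₀, r)) > δ V₃ r³`; take a smooth radial `φ`,
`φ = 1` on `B(x₀, r)`, `φ = 0` off `B(x₀, (1+η)r)`, `‖φ‖_{H¹} ≤ c(η) r^{1/2}`; by duality
`‖f‖_{H⁻¹} ‖φ‖_{H¹} ≥ ∫ f_i φ ≥ I − |II| − |III|` with `I > λ δ V₃ r³ ‖f‖_∞` (over `S ∩ B(x₀,r)`),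
`|II| ≤ (1 − δ) V₃ r³ ‖f‖_∞` (over `B(x₀,r) ∖ S`), `|III| ≤ ((1+η)³ − 1) V₃ r³ ‖f‖_∞` (the shell),
whence `‖f‖_{H⁻¹} > c*(η) r^{5/2} ‖f‖_∞ (λδ + δ − (1+η)³)`, positive for `η = η(λ, δ)` small since
`δ(1+λ) > 1` — a contradiction. **Theorem 26**: with `λ = 1/(2M)`, `δ = 3/4` one has
`3/4 > 1/(1 + 1/(2M))` (i.e. `M < 3/2`); `‖ω(τ)‖_{H⁻¹} ≤ ‖u(τ)‖₂ ≤ ‖u₀‖₂` (Fourier side: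
`|ξ_i|²/(1+|ξ|²) ≤ 1`; the energy inequality); so the hypothesis of Lemma 24 holds as soon as
`‖u₀‖₂ ≤ c* r^{5/2} ‖ω(τ)‖_∞`, "which forces the choice of the scale `r*`".

This file follows that architecture with two bookkeeping deviations, both only making the printed
constants explicit:

* The `H⁻¹`/`H¹` duality and the Fourier-side bound are replaced by their one-line classical content
  for the smooth slice `u(τ)`: `∫ ω_j φ = ∫ ⟪curl u, φ e_j⟫ = ∫ ⟪u, curl (φ e_j)⟫ = ∫ ⟪u, ∇φ × e_j⟫`
  (the tree's integration by parts for the curl, `integral_inner_curl_eq_integral_inner_curl`), so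
  `|∫ ω_j φ| ≤ ‖u(τ)‖₂ ‖∇φ‖₂ ≤ ‖u₀‖₂ · κ_curl K r^{-1} (V₃ ((1+η) r)³)^{1/2}` for the rescaled bump
  `φ(x) = Φ((x − x₀)/r)` (`‖∇φ‖ ≤ K/r`, `K = sup ‖∇Φ‖`): this is `‖φ‖_{H¹} ≤ c(η) r^{1/2}` with the
  `L²`-part of the `H¹` norm not even needed (so the restriction `r* ≤ 1` of the statement is not
  used), and `‖u(τ)‖₂ ≤ ‖u₀‖₂` is the Leray–Hopf energy inequality from `0`
  (`IsLerayHopfOn.weakGrad_energy`).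
* The printed "`1 < M < 3/2`" is quantified: `h* < 1/4` (from `(3/4)^{1/3} ≥ 3/4` and
  `sin(π/8) > 7/25`), hence `M = (2 − h*)/(2(1 − h*)) < 7/6`, and with `η = 1/100` the printed margin
  `κ = λδ + δ − (1+η)³ = (3/4)(1 + 1/(2M)) − (101/100)³ > 15/14 − 1.030301 > 0`
  (`BFG2019.sparsenessMargin_pos`). The constant "`c(‖u₀‖₂)` depending only on the initial energy"
  is then the explicit `c(E) = (E² K₂ /(V₃ κ)² + 1)^{1/5}` with `K₂ = (κ_curl K)² (101/100)³ V₃`,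
  `V₃ = m³(B(0,1))`: if `V^{j,σ}_τ` filled more than `3/4` of
  `B(x₀, r*)`, `r* = c(‖u₀‖₂) ‖ω(τ)‖_∞^{-2/5}`, the two displays give
  `‖ω‖_∞ V₃ κ r*³ < ∫ σ ω_j φ ≤ ‖u₀‖₂ K₂^{1/2} r*^{1/2}`, i.e. `‖ω‖_∞² r*⁵ (V₃κ)² < ‖u₀‖₂² K₂`, while
  `‖ω‖_∞² r*⁵ = c⁵ = ‖u₀‖₂² K₂/(V₃κ)² + 1` — absurd.

"Leray solution" enters only through `‖u(τ)‖₂ ≤ ‖u₀‖₂`; if `‖u₀‖₂ = ∞` in the junk sense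
(`(eLpNorm u₀ 2).toReal = 0` is then paired with `kineticEnergy u₀ = 0`) the same inequality chain
still closes (`2·kineticEnergy v ≤ (eLpNorm v 2).toReal²` for every `v`, a private lemma). The
degenerate slice `‖ω(τ)‖_∞ = 0` has empty super-level sets.

## Contents (all proved; namespace `Literature.Analysis.FluidPDE`)

* `BFG2019.hStar_lt_quarter`, `BFG2019.bfgM_lt_seven_sixths`, `BFG2019.sparsenessMargin_pos` —
  the printed "`1 < M < 3/2`, `3/4 > 1/(1 + 1/(2M))`" made quantitative.
* `BFG2019.exists_scaledBump` — the cut-off `φ` of Lemma 24 (`= 1` on `B(x₀,r)`, `= 0` off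
  `B(x₀, 1.01 r)`, `‖∇φ‖ ≤ K/r`).
* `BFG2019.abs_integral_curl_apply_mul_le` — the duality bound `|∫ (curl v)_j φ| ≤ ‖v‖₂ κ_curl B √m³(B̄(x₀,R))`.
* `BFG2019.integral_signedComponent_mul_ge` — the counting bound `∫ σ ω_j φ ≥ (L + N) m³(V ∩ B(x₀,r)) − N m³(B(x₀,R))`
  (`I − |II| − |III|`).
* `BFG2019.sq_toReal_eLpNorm_le_of_lerayHopf_unforced` — `‖u(τ)‖₂ ≤ ‖u₀‖₂` (with two private
  `L²`-bookkeeping lemmas).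
* `bradshawFarhatGrujic2019_apriori_componentSparseness_holds` — **Theorem 26**.

## References

* Z. Bradshaw, A. Farhat, Z. Grujić, *An algebraic reduction of the 'scaling gap' in the Navier–Stokes
  regularity problem*, Arch. Ration. Mech. Anal. 231 (2019) 1983–2005 = arXiv:1704.05546, §4:
  Def. 22, Rmk. 23, Lemma 24 (with its proof), Thm. 26 (with its proof), Rmks. 27–28 (pp. 11–12).
  [BradshawFarhatGrujic2018]
* J. Leray, Acta Math. 63 (1934), §III (5.2) (energy inequality from `0`; tree `IsLerayHopfOn`).
  [Leray1934]
-/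

noncomputable section

open MeasureTheory Set Function Filter Metric InnerProductSpace
open scoped ENNReal RealInnerProductSpace

namespace Literature.Analysis.FluidPDE

-- nested operator types (derivatives of derivatives)
set_option maxSynthPendingDepth 3

namespace BFG2019

/-! ### §0 The printed constants made quantitative: `h* < 1/4`, `M < 7/6`, the margin of Lemma 24 -/

/-- `h* = (2/π) arcsin((1 − (3/4)^{2/3})/(1 + (3/4)^{2/3})) < 1/4`: since `(3/4)^{1/3} ≥ 3/4` the
argument of `arcsin` is at most `7/25 < sin(π/8)`. (The paper only records `1 < M < 3/2`; this is the
quantitative form used below.) [cite: BradshawFarhatGrujic2018, §3 before Thm. 19 (arXiv:1704.05546, p. 9)] -/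
theorem hStar_lt_quarter : hStar < 1 / 4 := by
  set δ : ℝ := (3 / 4 : ℝ) ^ (1 / 3 : ℝ) with hδ
  have hδ34 : 3 / 4 ≤ δ := by
    have h : (3 / 4 : ℝ) ^ (1 : ℝ) ≤ (3 / 4 : ℝ) ^ (1 / 3 : ℝ) :=
      Real.rpow_le_rpow_of_exponent_ge (by norm_num) (by norm_num) (by norm_num)
    rwa [Real.rpow_one] at h
  have hδ1 : δ ≤ 1 := Real.rpow_le_one (by norm_num) (by norm_num) (by norm_num)
  set x : ℝ := (1 - δ ^ 2) / (1 + δ ^ 2) with hx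
  have hx_le : x ≤ 7 / 25 := by
    rw [hx, div_le_iff₀ (by positivity)]
    nlinarith
  -- `7/25 < sin (π/8)`
  have hp0 : (0 : ℝ) < Real.pi / 8 := by positivity
  have hp1 : Real.pi / 8 ≤ 1 := by linarith [Real.pi_lt_four]
  have hsin : (7 / 25 : ℝ) < Real.sin (Real.pi / 8) := by
    have h2 := Real.sin_gt_sub_cube hp0
    have hlo : (0.3925 : ℝ) < Real.pi / 8 := by linarith [Real.pi_gt_d2]
    have hp3 : (Real.pi / 8) ^ 3 ≤ Real.pi / 8 := by
      calc (Real.pi / 8) ^ 3 ≤ (Real.pi / 8) ^ 1 := pow_le_pow_of_le_one hp0.le hp1 (by norm_num)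
        _ = Real.pi / 8 := pow_one _
    linarith
  have harc : Real.arcsin x < Real.pi / 8 := by
    rw [Real.arcsin_lt_iff_lt_sin' ⟨by linarith [Real.pi_pos], by linarith [Real.pi_pos]⟩]
    exact hx_le.trans_lt hsin
  have hπ : (0 : ℝ) < 2 / Real.pi := by positivity
  show 2 / Real.pi * Real.arcsin ((1 - δ ^ 2) / (1 + δ ^ 2)) < 1 / 4
  rw [← hx]
  calc 2 / Real.pi * Real.arcsin x < 2 / Real.pi * (Real.pi / 8) := mul_lt_mul_of_pos_left harc hπ
    _ = 1 / 4 := by field_simp; ring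

/-- The absolute constant satisfies `M < 7/6` (the paper: "`1 < M < 3/2`"; `M = (2 − h*)/(2(1 − h*))`
with `h* < 1/4`). [cite: BradshawFarhatGrujic2018, §3 before Thm. 19 (arXiv:1704.05546, p. 9)] -/
theorem bfgM_lt_seven_sixths : bfgM < 7 / 6 := by
  have h0 := hStar_mem_Ioo
  have h4 := hStar_lt_quarter
  unfold bfgM
  rw [div_lt_iff₀ (by nlinarith [h0.2])]
  nlinarith [h0.1, h0.2]

/-- **The margin of Lemma 24 is positive at the parameters of Theorem 26.** With `λ = 1/(2M)`,
`δ = 3/4` and `η = 1/100` the printed margin `λδ + δ − (1 + η)³ = (3/4)(1/(2M) + 1) − (101/100)³` is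
positive ("our choice of parameters implies that `3/4 > 1/(1 + 1/(2M))`, and Lemma 24 is
applicable" — quantitatively `> 15/14 − 1.030301 > 0` since `M < 7/6`).
[cite: BradshawFarhatGrujic2018, proof of Lemma 24 and proof of Thm. 26 (arXiv:1704.05546, pp. 11–12)] -/
theorem sparsenessMargin_pos : 0 < 3 / 4 * (1 / (2 * bfgM) + 1) - (101 / 100 : ℝ) ^ 3 := by
  have hM := bfgM_lt_seven_sixths
  have hM1 := one_lt_bfgM
  have h : 3 / 7 < 1 / (2 * bfgM) := by
    rw [lt_div_iff₀ (by linarith)]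
    nlinarith
  nlinarith

/-! ### §1 The cut-off of Lemma 24, rescaled: `φ = 1` on `B(x₀, r)`, `φ = 0` off `B(x₀, 1.01 r)`,
`‖∇φ‖ ≤ K / r` -/

/-- **The test function of Lemma 24** ("a smooth radial (monotone) function, equal to `1` in
`B(x₀, r)`, and vanishing outside `B(x₀, (1+η)r)`", with "`‖φ‖_{H¹} ≤ c(η) r^{1/2}`"), `η = 1/100`:
there is an absolute `K ≥ 0` such that for every centre `x₀` and radius `r > 0` some `C¹` compactly
supported `φ : ℝ³ → [0, 1]` equals `1` on `B(x₀, r)`, vanishes off `B(x₀, 1.01 r)`, and has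
`‖∇φ(x)‖ ≤ K/r` everywhere (and `∇φ = 0` off `B̄(x₀, 1.01 r)`). Construction: `φ(x) = Φ(r⁻¹(x − x₀))`
for one fixed bump `Φ` (`ContDiffBump 0` with radii `1 < 1.01`), `K = sup ‖∇Φ‖`.
[cite: BradshawFarhatGrujic2018, proof of Lemma 24 (arXiv:1704.05546, p. 11)] -/
theorem exists_scaledBump :
    ∃ K : ℝ, 0 ≤ K ∧ ∀ (x₀ : EuclideanSpace ℝ (Fin 3)) (r : ℝ), 0 < r →
      ∃ φ : EuclideanSpace ℝ (Fin 3) → ℝ, ContDiff ℝ 1 φ ∧ HasCompactSupport φ ∧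
        (∀ x, 0 ≤ φ x) ∧ (∀ x, φ x ≤ 1) ∧ (∀ x ∈ ball x₀ r, φ x = 1) ∧
        (∀ x, x ∉ ball x₀ (101 / 100 * r) → φ x = 0) ∧
        (∀ x, ‖fderiv ℝ φ x‖ ≤ K / r) ∧
        (∀ x, x ∉ closedBall x₀ (101 / 100 * r) → fderiv ℝ φ x = 0) := by
  let Φ : ContDiffBump (0 : EuclideanSpace ℝ (Fin 3)) := ⟨1, 101 / 100, one_pos, by norm_num⟩
  have hΦd : ContDiff ℝ 1 (Φ : EuclideanSpace ℝ (Fin 3) → ℝ) := Φ.contDiff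
  have hΦc : HasCompactSupport (Φ : EuclideanSpace ℝ (Fin 3) → ℝ) := Φ.hasCompactSupport
  have hcont : Continuous (fderiv ℝ (Φ : EuclideanSpace ℝ (Fin 3) → ℝ)) :=
    hΦd.continuous_fderiv one_ne_zero
  obtain ⟨K, hK⟩ := (hΦc.fderiv (𝕜 := ℝ)).exists_bound_of_continuous hcont
  have hK0 : 0 ≤ K := (norm_nonneg _).trans (hK 0)
  refine ⟨K, hK0, fun x₀ r hr => ?_⟩
  set A : EuclideanSpace ℝ (Fin 3) → EuclideanSpace ℝ (Fin 3) := fun x => r⁻¹ • (x - x₀) with hA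
  have hAnorm : ∀ x, ‖A x‖ = r⁻¹ * ‖x - x₀‖ := fun x => by
    show ‖r⁻¹ • (x - x₀)‖ = r⁻¹ * ‖x - x₀‖
    rw [norm_smul, norm_inv, Real.norm_eq_abs, abs_of_pos hr]
  have hAd : ∀ x, HasFDerivAt A (r⁻¹ • ContinuousLinearMap.id ℝ (EuclideanSpace ℝ (Fin 3))) x :=
    fun x => ((hasFDerivAt_id x).sub_const x₀).const_smul r⁻¹
  have hAc : ContDiff ℝ 1 A := (contDiff_id.sub contDiff_const).const_smul r⁻¹
  -- support of `φ = Φ ∘ A`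
  have hzero : ∀ x, x ∉ ball x₀ (101 / 100 * r) → Φ (A x) = 0 := by
    intro x hx
    apply Φ.zero_of_le_dist
    rw [dist_zero_right, hAnorm]
    rw [mem_ball, dist_eq_norm, not_lt] at hx
    calc (Φ.rOut : ℝ) = r⁻¹ * (101 / 100 * r) := by field_simp; ring
      _ ≤ r⁻¹ * ‖x - x₀‖ := by gcongr
  have htsupp : tsupport (fun x => Φ (A x)) ⊆ closedBall x₀ (101 / 100 * r) := by
    refine closure_minimal ?_ isClosed_closedBall
    intro x hx
    by_contra hx'
    exact hx (hzero x fun h => hx' (ball_subset_closedBall h))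
  refine ⟨fun x => Φ (A x), hΦd.comp hAc, ?_, fun x => Φ.nonneg, fun x => Φ.le_one, ?_, hzero,
    ?_, ?_⟩
  · exact HasCompactSupport.of_support_subset_isCompact (isCompact_closedBall x₀ (101 / 100 * r))
      ((subset_tsupport _).trans htsupp)
  · intro x hx
    apply Φ.one_of_mem_closedBall
    rw [mem_closedBall, dist_zero_right, hAnorm]
    rw [mem_ball, dist_eq_norm] at hx
    calc r⁻¹ * ‖x - x₀‖ ≤ r⁻¹ * r := by gcongr
      _ = Φ.rIn := by rw [inv_mul_cancel₀ hr.ne']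
  · intro x
    have hΦx : HasFDerivAt (Φ : EuclideanSpace ℝ (Fin 3) → ℝ) (fderiv ℝ Φ (A x)) (A x) :=
      ((hΦd.differentiable one_ne_zero) (A x)).hasFDerivAt
    have hcomp : HasFDerivAt (fun y => Φ (A y))
        ((fderiv ℝ (Φ : EuclideanSpace ℝ (Fin 3) → ℝ) (A x)).comp
          (r⁻¹ • ContinuousLinearMap.id ℝ (EuclideanSpace ℝ (Fin 3)))) x :=
      hΦx.comp x (hAd x)
    rw [hcomp.fderiv]
    calc ‖(fderiv ℝ (Φ : EuclideanSpace ℝ (Fin 3) → ℝ) (A x)).comp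
          (r⁻¹ • ContinuousLinearMap.id ℝ (EuclideanSpace ℝ (Fin 3)))‖
        ≤ ‖fderiv ℝ (Φ : EuclideanSpace ℝ (Fin 3) → ℝ) (A x)‖ *
          ‖r⁻¹ • ContinuousLinearMap.id ℝ (EuclideanSpace ℝ (Fin 3))‖ :=
          ContinuousLinearMap.opNorm_comp_le _ _
      _ ≤ K * (r⁻¹ * 1) := by
          rw [norm_smul, Real.norm_eq_abs, abs_of_pos (inv_pos.2 hr)]
          gcongr
          · exact hK _
          · exact ContinuousLinearMap.norm_id_le
      _ = K / r := by rw [mul_one, div_eq_mul_inv]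
  · intro x hx
    exact fderiv_of_notMem_tsupport ℝ fun h => hx (htsupp h)

/-! ### §2 The duality bound of Lemma 24: `|∫ (curl v)_j φ| ≤ ‖v‖₂ · κ_curl B · m³(B̄(x₀, R))^{1/2}` -/

/-- **"`‖f‖_{H⁻¹} ‖φ‖_{H¹} ≥ |∫ f_i φ|`" for `f = curl v`, in classical form.** For a `C¹` field
`v ∈ L²(ℝ³)` and a `C¹` compactly supported `φ` with `‖∇φ‖ ≤ B` and `∇φ = 0` off `B̄(x₀, R)`:
`|∫ (curl v)_j φ| ≤ ‖v‖₂ · ‖curlCLM‖ B (m³ B̄(x₀, R))^{1/2}`. Proof: `∫ (curl v)_j φ = ∫ ⟪curl v, φ e_j⟫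
= ∫ ⟪v, curl (φ e_j)⟫` (integration by parts for the curl), Cauchy–Schwarz, and
`‖curl (φ e_j)‖ ≤ ‖curlCLM‖ ‖∇φ‖ ≤ ‖curlCLM‖ B 1_{B̄(x₀,R)}`. This replaces the printed Fourier-side
estimate `I_{i,j} ≤ ‖u(τ)‖₂²` together with "`‖φ‖_{H¹} ≤ c(η) r^{1/2}`".
[cite: BradshawFarhatGrujic2018, proof of Lemma 24 (duality display) and proof of Thm. 26 (arXiv:1704.05546, pp. 11–12)] -/
theorem abs_integral_curl_apply_mul_le
    {v : EuclideanSpace ℝ (Fin 3) → EuclideanSpace ℝ (Fin 3)} (hv : ContDiff ℝ 1 v)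
    (hv2 : MemLp v 2 volume) {φ : EuclideanSpace ℝ (Fin 3) → ℝ} (hφ : ContDiff ℝ 1 φ)
    (hφc : HasCompactSupport φ) {x₀ : EuclideanSpace ℝ (Fin 3)} {R B : ℝ} (hB : 0 ≤ B)
    (hφB : ∀ x, ‖fderiv ℝ φ x‖ ≤ B) (hφ0 : ∀ x, x ∉ closedBall x₀ R → fderiv ℝ φ x = 0)
    (j : Fin 3) :
    |∫ x, (curl v x) j * φ x| ≤
      (eLpNorm v 2 volume).toReal *
        (‖curlCLM‖ * B * Real.sqrt (volume.real (closedBall x₀ R))) := by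
  set e : EuclideanSpace ℝ (Fin 3) := EuclideanSpace.single j (1 : ℝ) with he
  have he1 : ‖e‖ = 1 := by rw [he, PiLp.norm_single, norm_one]
  set Ψ : EuclideanSpace ℝ (Fin 3) → EuclideanSpace ℝ (Fin 3) := fun x => φ x • e with hΨ
  have hΨd : ContDiff ℝ 1 Ψ := hφ.smul contDiff_const
  have hΨc : HasCompactSupport Ψ := hφc.smul_right
  -- the pairing as an inner product
  have hpair : ∫ x, (curl v x) j * φ x = ∫ x, ⟪curl v x, Ψ x⟫ := by
    refine integral_congr_ae (Eventually.of_forall fun x => ?_)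
    simp only [hΨ, he, real_inner_smul_right, EuclideanSpace.inner_single_right]
    simp
    ring
  rw [hpair, integral_inner_curl_eq_integral_inner_curl hv hΨd hΨc]
  -- Cauchy–Schwarz
  have hcΨ2 : MemLp (curl Ψ) 2 volume :=
    (continuous_curl hΨd).memLp_of_hasCompactSupport (hasCompactSupport_curl hΨc)
  have hCS := FunctionSpaces.abs_integral_inner_le_eLpNorm_two_mul hv2 hcΨ2
  refine hCS.trans (mul_le_mul_of_nonneg_left ?_ ENNReal.toReal_nonneg)
  -- pointwise bound on `curl Ψ`
  have hpt : ∀ x, ‖curl Ψ x‖ ≤ (closedBall x₀ R).indicator (fun _ => ‖curlCLM‖ * B) x := by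
    intro x
    have hfd : fderiv ℝ Ψ x = (fderiv ℝ φ x).smulRight e :=
      (((hφ.differentiable one_ne_zero) x).hasFDerivAt.smul_const e).fderiv
    have h1 : ‖curl Ψ x‖ ≤ ‖curlCLM‖ * ‖fderiv ℝ φ x‖ := by
      calc ‖curl Ψ x‖ ≤ ‖curlCLM‖ * ‖fderiv ℝ Ψ x‖ := norm_curl_le Ψ x
        _ = ‖curlCLM‖ * ‖fderiv ℝ φ x‖ := by
            rw [hfd, ContinuousLinearMap.norm_smulRight_apply, he1, mul_one]
    by_cases hx : x ∈ closedBall x₀ R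
    · rw [indicator_of_mem hx]
      exact h1.trans (mul_le_mul_of_nonneg_left (hφB x) (norm_nonneg _))
    · rw [indicator_of_notMem hx]
      simpa [hφ0 x hx] using h1
  have hmono : eLpNorm (curl Ψ) 2 volume ≤
      eLpNorm ((closedBall x₀ R).indicator fun _ => ‖curlCLM‖ * B) 2 volume :=
    eLpNorm_mono_real hpt
  have hind : eLpNorm ((closedBall x₀ R).indicator fun _ => (‖curlCLM‖ * B : ℝ)) 2 volume ≤
      ‖(‖curlCLM‖ * B : ℝ)‖ₑ * volume (closedBall x₀ R) ^ (1 / (2 : ℝ≥0∞).toReal) :=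
    eLpNorm_indicator_const_le _ _
  have hfin : volume (closedBall x₀ R) ≠ ∞ := (isCompact_closedBall x₀ R).measure_lt_top.ne
  have htop : ‖(‖curlCLM‖ * B : ℝ)‖ₑ * volume (closedBall x₀ R) ^ (1 / (2 : ℝ≥0∞).toReal) ≠ ∞ :=
    ENNReal.mul_ne_top enorm_ne_top (ENNReal.rpow_ne_top_of_nonneg (by norm_num) hfin)
  calc (eLpNorm (curl Ψ) 2 volume).toReal
      ≤ (‖(‖curlCLM‖ * B : ℝ)‖ₑ * volume (closedBall x₀ R) ^ (1 / (2 : ℝ≥0∞).toReal)).toReal :=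
        ENNReal.toReal_mono htop (hmono.trans hind)
    _ = ‖curlCLM‖ * B * Real.sqrt (volume.real (closedBall x₀ R)) := by
        rw [ENNReal.toReal_mul, ← ENNReal.toReal_rpow, ENNReal.toReal_ofNat, measureReal_def,
          Real.sqrt_eq_rpow]
        congr 1
        rw [← ofReal_norm, ENNReal.toReal_ofReal (norm_nonneg _), Real.norm_eq_abs,
          abs_of_nonneg (mul_nonneg (norm_nonneg _) hB)]

/-! ### §3 The counting bound of Lemma 24: `I − |II| − |III|` -/

/-- **The domain decomposition `I − |II| − |III|` of the proof of Lemma 24.** Let `ω` be continuous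
with `|ω_j| ≤ N`, `σ = ±1`, `L` real, and let `φ : ℝ³ → [0,1]` be continuous, compactly supported, `= 1`
on `B(x₀, r)` and `= 0` off `B(x₀, R)`, `r ≤ R`. With `V = {x : σ ω_j(x) > L}`:
`∫ σ ω_j φ ≥ (L + N) m³(V ∩ B(x₀, r)) − N m³(B(x₀, R))`, i.e. `≥ I − |II| − |III|` with
`I ≥ L m³(V ∩ B(x₀,r))`, `|II| ≤ N (m³(B(x₀,r)) − m³(V ∩ B(x₀,r)))`, `|III| ≤ N (m³ B(x₀,R) − m³ B(x₀,r))`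
(the integrand dominates `(L + N) 1_{V ∩ B(x₀,r)} − N 1_{B(x₀,R)}` pointwise).
[cite: BradshawFarhatGrujic2018, proof of Lemma 24, estimates (I)–(III) (arXiv:1704.05546, p. 11)] -/
theorem integral_signedComponent_mul_ge
    {ω : EuclideanSpace ℝ (Fin 3) → EuclideanSpace ℝ (Fin 3)} (hω : Continuous ω) {j : Fin 3}
    {N L σ : ℝ} (hN : ∀ x, |ω x j| ≤ N) (hσ : σ = 1 ∨ σ = -1)
    {φ : EuclideanSpace ℝ (Fin 3) → ℝ} (hφm : Continuous φ) (hφc : HasCompactSupport φ)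
    (hφ0 : ∀ x, 0 ≤ φ x) (hφ1 : ∀ x, φ x ≤ 1) {x₀ : EuclideanSpace ℝ (Fin 3)} {r R : ℝ}
    (hrR : r ≤ R) (hφone : ∀ x ∈ ball x₀ r, φ x = 1) (hφzero : ∀ x, x ∉ ball x₀ R → φ x = 0) :
    (L + N) * volume.real ({x | L < σ * ω x j} ∩ ball x₀ r) - N * volume.real (ball x₀ R) ≤
      ∫ x, σ * ω x j * φ x := by
  set V : Set (EuclideanSpace ℝ (Fin 3)) := {x | L < σ * ω x j} with hV
  have hωj : Continuous fun x => ω x j :=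
    (EuclideanSpace.proj (𝕜 := ℝ) j).continuous.comp hω
  have hVo : IsOpen V := isOpen_lt continuous_const (continuous_const.mul hωj)
  have hSm : MeasurableSet (V ∩ ball x₀ r) := hVo.measurableSet.inter measurableSet_ball
  have hN0 : 0 ≤ N := (abs_nonneg _).trans (hN x₀)
  have hσabs : |σ| = 1 := by rcases hσ with h | h <;> simp [h]
  -- the minorant
  set g : EuclideanSpace ℝ (Fin 3) → ℝ := fun x =>
    (V ∩ ball x₀ r).indicator (fun _ => L + N) x - (ball x₀ R).indicator (fun _ => N) x with hg
  have hS_fin : volume (V ∩ ball x₀ r) ≠ ∞ :=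
    (measure_mono inter_subset_right).trans_lt measure_ball_lt_top |>.ne
  have hB_fin : volume (ball x₀ R) ≠ ∞ := measure_ball_lt_top.ne
  have hint1 : Integrable ((V ∩ ball x₀ r).indicator fun _ => (L + N : ℝ)) volume :=
    (integrableOn_const hS_fin).integrable_indicator hSm
  have hint2 : Integrable ((ball x₀ R).indicator fun _ => (N : ℝ)) volume :=
    (integrableOn_const hB_fin).integrable_indicator measurableSet_ball
  have hgint : Integrable g volume := hint1.sub hint2
  have hfint : Integrable (fun x => σ * ω x j * φ x) volume :=
    ((continuous_const.mul hωj).mul hφm).integrable_of_hasCompactSupport hφc.mul_left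
  have hg_eval : ∫ x, g x = (L + N) * volume.real (V ∩ ball x₀ r) - N * volume.real (ball x₀ R) := by
    rw [hg, integral_sub hint1 hint2, integral_indicator_const _ hSm,
      integral_indicator_const _ measurableSet_ball, smul_eq_mul, smul_eq_mul]
    ring
  rw [← hg_eval]
  refine integral_mono hgint hfint fun x => ?_
  -- pointwise comparison
  have habs : |σ * ω x j * φ x| ≤ N := by
    rw [abs_mul, abs_mul, hσabs, one_mul, abs_of_nonneg (hφ0 x)]
    calc |ω x j| * φ x ≤ N * 1 := mul_le_mul (hN x) (hφ1 x) (hφ0 x) hN0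
      _ = N := mul_one N
  have hlow : -N ≤ σ * ω x j * φ x := (abs_le.1 habs).1
  show g x ≤ σ * ω x j * φ x
  simp only [hg]
  by_cases hxS : x ∈ V ∩ ball x₀ r
  · have hxR : x ∈ ball x₀ R := ball_subset_ball hrR hxS.2
    rw [indicator_of_mem hxS, indicator_of_mem hxR, hφone x hxS.2, mul_one]
    have : L < σ * ω x j := hxS.1
    linarith
  · rw [indicator_of_notMem hxS]
    by_cases hxR : x ∈ ball x₀ R
    · rw [indicator_of_mem hxR]
      linarith
    · rw [indicator_of_notMem hxR, hφzero x hxR]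
      simp

/-! ### §4 `‖u(τ)‖₂ ≤ ‖u₀‖₂`: the energy inequality from `0` of a Leray–Hopf solution -/

/-- For `v ∈ L²`: `(‖v‖₂)² = 2 · kineticEnergy v` (real form of the tree's `eEnergy_eq_ofReal`;
private plumbing). [folklore] -/
private theorem toReal_eLpNorm_sq_eq_two_mul_kineticEnergy
    {v : EuclideanSpace ℝ (Fin 3) → EuclideanSpace ℝ (Fin 3)} (hv : MemLp v 2 volume) :
    (eLpNorm v 2 volume).toReal ^ 2 = 2 * VectorCalculus.kineticEnergy v := by
  rw [← ENNReal.toReal_pow, ← eEnergy_eq_eLpNorm_sq, eEnergy_eq_ofReal _ hv,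
    ENNReal.toReal_ofReal (mul_nonneg zero_le_two (kineticEnergy_nonneg _))]

/-- For EVERY `v`: `2 · kineticEnergy v ≤ (‖v‖₂)²` (equality when `‖v‖²` is integrable; otherwise the
left side is the junk value `0`). This lets the energy inequality be used without a measurability
hypothesis on the datum (private plumbing). [folklore] -/
private theorem two_mul_kineticEnergy_le_toReal_eLpNorm_sq
    (v : EuclideanSpace ℝ (Fin 3) → EuclideanSpace ℝ (Fin 3)) :
    2 * VectorCalculus.kineticEnergy v ≤ (eLpNorm v 2 volume).toReal ^ 2 := by
  unfold VectorCalculus.kineticEnergy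
  by_cases hint : Integrable (fun x => ‖v x‖ ^ 2) volume
  · have h1 : ∫ x, ‖v x‖ ^ 2 = (∫⁻ x, ENNReal.ofReal (‖v x‖ ^ 2)).toReal :=
      integral_eq_lintegral_of_nonneg_ae (Eventually.of_forall fun _ => sq_nonneg _)
        hint.aestronglyMeasurable
    have h2 : ∫⁻ x, ENNReal.ofReal (‖v x‖ ^ 2) = eEnergy v :=
      lintegral_congr fun x => by
        rw [← ofReal_norm, ENNReal.ofReal_pow (norm_nonneg _)]
    rw [← mul_assoc, mul_inv_cancel₀ two_ne_zero, one_mul, h1, h2, eEnergy_eq_eLpNorm_sq,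
      ENNReal.toReal_pow]
  · rw [integral_undef hint, mul_zero, mul_zero]
    positivity

/-- **`‖u(t)‖₂ ≤ ‖u₀‖₂` for an unforced Leray–Hopf solution** (squared, `toReal` form): the energy
inequality from `0` (`IsLerayHopfOn.weakGrad_energy`, Leray 1934 (5.2)) with zero work term and the
dissipation dropped (`ν ≥ 0`). This is the step "`‖u(τ)‖₂² ≤ ‖u₀‖₂²` (by the energy inequality)" of
the proof of Theorem 26. [cite: BradshawFarhatGrujic2018, proof of Thm. 26 (arXiv:1704.05546, p. 12)] -/
theorem sq_toReal_eLpNorm_le_of_lerayHopf_unforced {T ν : ℝ}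
    {u₀ : EuclideanSpace ℝ (Fin 3) → EuclideanSpace ℝ (Fin 3)}
    {u : ℝ → EuclideanSpace ℝ (Fin 3) → EuclideanSpace ℝ (Fin 3)}
    (h : IsLerayHopfOn T ν 0 u₀ u) (hν : 0 ≤ ν) {t : ℝ} (ht : t ∈ Icc 0 T) :
    (eLpNorm (u t) 2 volume).toReal ^ 2 ≤ (eLpNorm u₀ 2 volume).toReal ^ 2 := by
  obtain ⟨G, -, -, h0, -⟩ := h.weakGrad_energy
  have hE := h0 t ht
  simp only [Pi.zero_apply, inner_zero_left, integral_zero, intervalIntegral.integral_zero,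
    add_zero] at hE
  have hD : 0 ≤ ν * (∫⁻ τ in Ioo 0 t, ∫⁻ x, ENNReal.ofReal (frobeniusNormSq (G τ x))).toReal :=
    mul_nonneg hν ENNReal.toReal_nonneg
  rw [toReal_eLpNorm_sq_eq_two_mul_kineticEnergy (h.memLp t ht)]
  linarith [two_mul_kineticEnergy_le_toReal_eLpNorm_sq u₀]

end BFG2019

/-! ### §5 Theorem 26 -/

/-- **Bradshaw–Farhat–Grujić 2019, Theorem 26 (a-priori 3D sparseness of the vorticity component
super-level sets at scale `‖ω‖_∞^{−2/5}`), PROVED.** There is a positive function `c` of the initial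
energy such that for every unforced Leray–Hopf solution on `ℝ³ × [0, T)` which is classical on `(0, T)`
with bounded vorticity slices, and every `τ ∈ (0, T)` (the printed restriction `r* ≤ 1` is carried
but not needed), each super-level set `V^{j,±}_τ = {±ω_j(·, τ) > ‖ω(τ)‖_∞/(2M)}` is 3D `3/4`-sparse
around every `x₀` at scale `r* = c(‖u₀‖₂) ‖ω(τ)‖_∞^{−2/5}`. Proof = the printed one (Lemma 24 with
`λ = 1/(2M)`, `δ = 3/4`, and `‖ω(τ)‖_{H⁻¹} ≤ ‖u(τ)‖₂ ≤ ‖u₀‖₂`), assembled from §§0–4; see the module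
docstring for the two bookkeeping deviations (classical integration by parts for the duality step;
the margin `M < 7/6` made explicit) and the explicit `c`.
[cite: BradshawFarhatGrujic2018, Thm. 26 with Lemma 24, Def. 13, Rmks. 27–28 (arXiv:1704.05546, pp. 11–12)] -/
theorem bradshawFarhatGrujic2019_apriori_componentSparseness_holds :
    bradshawFarhatGrujic2019_apriori_componentSparseness := by
  obtain ⟨K, hK0, hbump⟩ := BFG2019.exists_scaledBump
  -- absolute constants
  set V₃ : ℝ := volume.real (ball (0 : EuclideanSpace ℝ (Fin 3)) 1) with hV₃
  have hV₃pos : 0 < V₃ := by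
    rw [hV₃, measureReal_def]
    exact ENNReal.toReal_pos (measure_ball_pos volume _ one_pos).ne' measure_ball_lt_top.ne
  set κ : ℝ := 3 / 4 * (1 / (2 * BFG2019.bfgM) + 1) - (101 / 100 : ℝ) ^ 3 with hκ
  have hκpos : 0 < κ := BFG2019.sparsenessMargin_pos
  have hM1 : 1 < BFG2019.bfgM := BFG2019.one_lt_bfgM
  have hM0 : 0 < BFG2019.bfgM := zero_lt_one.trans hM1
  set K₂ : ℝ := (‖curlCLM‖ * K) ^ 2 * ((101 / 100) ^ 3 * V₃) with hK₂
  have hK₂0 : 0 ≤ K₂ := by positivity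
  refine ⟨fun E => (E ^ 2 * K₂ / (V₃ * κ) ^ 2 + 1) ^ (1 / 5 : ℝ),
    fun E => Real.rpow_pos_of_pos (by positivity) _, ?_⟩
  intro ν T hν hT u₀ u p hLH hNS τ hτ hB _ x₀ j σ hσ
  dsimp only
  -- names
  set N : ℝ := BFG2019.vortSup u τ with hN
  set E₀ : ℝ := (eLpNorm u₀ 2 volume).toReal with hE₀
  set c : ℝ := (E₀ ^ 2 * K₂ / (V₃ * κ) ^ 2 + 1) ^ (1 / 5 : ℝ) with hc
  set r : ℝ := c / N ^ (2 / 5 : ℝ) with hr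
  set L : ℝ := N / (2 * BFG2019.bfgM) with hL
  -- the slice `u(τ)` and its vorticity
  have hu1 : ContDiff ℝ 1 (u τ) := (hNS.contDiff_velocity hτ).of_le (by norm_cast)
  have hωc : Continuous (curl (u τ)) := continuous_curl hu1
  have habs : ∀ x, |curl (u τ) x j| ≤ N := fun x =>
    (BFG2019.abs_apply_le_maxNorm _ j).trans (le_ciSup hB x)
  have hN0 : 0 ≤ N := (abs_nonneg _).trans (habs x₀)
  show volume (BFG2019.componentSuperlevel u τ j σ L ∩ ball x₀ r) ≤
    ENNReal.ofReal (3 / 4) * volume (ball x₀ r)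
  have hVdef : BFG2019.componentSuperlevel u τ j σ L = {x | L < σ * curl (u τ) x j} := rfl
  rcases hN0.eq_or_lt with hN00 | hNpos
  · -- degenerate slice `‖ω(τ)‖_∞ = 0`: the super-level set is empty
    have hempty : BFG2019.componentSuperlevel u τ j σ L ∩ ball x₀ r = ∅ := by
      rw [hVdef, Set.eq_empty_iff_forall_notMem]
      rintro x ⟨hx, -⟩
      have h0 : curl (u τ) x j = 0 := by
        have h := habs x
        rw [← hN00] at h
        exact abs_nonpos_iff.1 h
      have hL0 : L = 0 := by rw [hL, ← hN00, zero_div]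
      rw [Set.mem_setOf_eq, h0, hL0, mul_zero] at hx
      exact lt_irrefl _ hx
    rw [hempty, measure_empty]
    exact zero_le
  -- `‖ω(τ)‖_∞ > 0`: suppose `V ∩ B(x₀, r*)` fills more than `3/4` of the ball
  by_contra hns
  rw [not_le] at hns
  have hbase0 : 0 ≤ E₀ ^ 2 * K₂ / (V₃ * κ) ^ 2 + 1 := by positivity
  have hcpos : 0 < c := Real.rpow_pos_of_pos (by positivity) _
  have hrpos : 0 < r := div_pos hcpos (Real.rpow_pos_of_pos hNpos _)
  obtain ⟨φ, hφd, hφc, hφ0, hφ1, hφone, hφzero, hφB, hφfd0⟩ := hbump x₀ r hrpos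
  -- volumes of balls
  have hfin3 : Module.finrank ℝ (EuclideanSpace ℝ (Fin 3)) = 3 := finrank_euclideanSpace_fin
  have hvol_ball : ∀ s : ℝ, 0 < s → volume.real (ball x₀ s) = s ^ 3 * V₃ := fun s hs => by
    rw [measureReal_def, Measure.addHaar_ball_of_pos volume x₀ hs, hfin3, ENNReal.toReal_mul,
      ENNReal.toReal_ofReal (by positivity), hV₃, measureReal_def]
  have hvol_cball : volume.real (closedBall x₀ (101 / 100 * r)) = (101 / 100 * r) ^ 3 * V₃ := by
    rw [measureReal_def, Measure.addHaar_closedBall volume x₀ (by positivity), hfin3,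
      ENNReal.toReal_mul, ENNReal.toReal_ofReal (by positivity), hV₃, measureReal_def]
  -- non-sparseness in real form: `(3/4) m³(B(x₀,r)) < m³(V ∩ B(x₀,r))`
  set S : Set (EuclideanSpace ℝ (Fin 3)) := BFG2019.componentSuperlevel u τ j σ L ∩ ball x₀ r
    with hS
  have hSfin : volume S ≠ ∞ :=
    ((measure_mono inter_subset_right).trans_lt measure_ball_lt_top).ne
  have hns' : 3 / 4 * volume.real (ball x₀ r) < volume.real S := by
    have h := ENNReal.toReal_strict_mono hSfin hns
    rwa [ENNReal.toReal_mul, ENNReal.toReal_ofReal (by norm_num : (0 : ℝ) ≤ 3 / 4),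
      ← measureReal_def, ← measureReal_def] at h
  -- the pairing `I = ∫ σ ω_j φ`
  set I : ℝ := ∫ x, σ * curl (u τ) x j * φ x with hI
  -- lower bound `I ≥ I − |II| − |III|`
  have hlow : (L + N) * volume.real S - N * volume.real (ball x₀ (101 / 100 * r)) ≤ I :=
    BFG2019.integral_signedComponent_mul_ge hωc habs hσ hφd.continuous hφc hφ0 hφ1
      (by linarith : r ≤ 101 / 100 * r) hφone hφzero
  -- hence `‖ω‖_∞ V₃ κ r³ < I`
  have hL_eq : L + N = N * (1 / (2 * BFG2019.bfgM) + 1) := by rw [hL]; ring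
  have hLN : 0 < L + N := by rw [hL_eq]; positivity
  have hlow' : N * V₃ * κ * r ^ 3 < I := by
    have h1 : (L + N) * (3 / 4 * volume.real (ball x₀ r)) < (L + N) * volume.real S :=
      mul_lt_mul_of_pos_left hns' hLN
    rw [hvol_ball r hrpos] at h1
    rw [hvol_ball (101 / 100 * r) (by positivity)] at hlow
    have h2 : N * V₃ * κ * r ^ 3 =
        (L + N) * (3 / 4 * (r ^ 3 * V₃)) - N * ((101 / 100 * r) ^ 3 * V₃) := by
      rw [hL_eq, hκ]
      ring
    linarith
  -- upper bound (duality): `|∫ ω_j φ| ≤ ‖u(τ)‖₂ κ_curl (K/r) (m³ B̄(x₀, 1.01 r))^{1/2}`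
  have hτI : τ ∈ Icc 0 T := ⟨hτ.1.le, hτ.2.le⟩
  have hup : |∫ x, curl (u τ) x j * φ x| ≤ (eLpNorm (u τ) 2 volume).toReal *
      (‖curlCLM‖ * (K / r) * Real.sqrt (volume.real (closedBall x₀ (101 / 100 * r)))) :=
    BFG2019.abs_integral_curl_apply_mul_le hu1 (hLH.memLp τ hτI) hφd hφc
      (div_nonneg hK0 hrpos.le) hφB hφfd0 j
  have hIabs : I ≤ |∫ x, curl (u τ) x j * φ x| := by
    have hσabs : |σ| = 1 := by rcases hσ with h | h <;> simp [h]
    have h1 : I = σ * ∫ x, curl (u τ) x j * φ x := by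
      rw [hI, ← integral_const_mul]
      exact integral_congr_ae (Eventually.of_forall fun x => by ring)
    rw [h1]
    calc σ * ∫ x, curl (u τ) x j * φ x ≤ |σ * ∫ x, curl (u τ) x j * φ x| := le_abs_self _
      _ = |∫ x, curl (u τ) x j * φ x| := by rw [abs_mul, hσabs, one_mul]
  -- energy inequality: `‖u(τ)‖₂² ≤ ‖u₀‖₂²`
  have hEτ := BFG2019.sq_toReal_eLpNorm_le_of_lerayHopf_unforced hLH hν.le hτI
  set Eτ : ℝ := (eLpNorm (u τ) 2 volume).toReal with hEτdef
  have hA0 : 0 ≤ N * V₃ * κ * r ^ 3 := by positivity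
  have hchain : N * V₃ * κ * r ^ 3 <
      Eτ * (‖curlCLM‖ * (K / r) * Real.sqrt ((101 / 100 * r) ^ 3 * V₃)) := by
    rw [← hvol_cball]
    linarith
  -- square: `(‖ω‖_∞ V₃ κ r³)² < ‖u₀‖₂² K₂ r`
  have hrne : r ≠ 0 := hrpos.ne'
  have hsq : (N * V₃ * κ * r ^ 3) ^ 2 <
      Eτ ^ 2 * ((‖curlCLM‖ * K) ^ 2 * ((101 / 100) ^ 3 * V₃)) * r := by
    have h := pow_lt_pow_left₀ hchain hA0 two_ne_zero
    have hsqrt : Real.sqrt ((101 / 100 * r) ^ 3 * V₃) ^ 2 = (101 / 100 * r) ^ 3 * V₃ :=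
      Real.sq_sqrt (by positivity)
    calc (N * V₃ * κ * r ^ 3) ^ 2
        < (Eτ * (‖curlCLM‖ * (K / r) * Real.sqrt ((101 / 100 * r) ^ 3 * V₃))) ^ 2 := h
      _ = Eτ ^ 2 * ((‖curlCLM‖ * K) ^ 2 * ((101 / 100) ^ 3 * V₃)) * r := by
          rw [mul_pow, mul_pow, mul_pow, hsqrt]
          field_simp
  -- i.e. `‖ω‖_∞² r⁵ (V₃ κ)² < ‖u₀‖₂² K₂`
  have hsq' : N ^ 2 * r ^ 5 * (V₃ * κ) ^ 2 < E₀ ^ 2 * K₂ := by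
    have h1 : (N * V₃ * κ * r ^ 3) ^ 2 = N ^ 2 * r ^ 5 * (V₃ * κ) ^ 2 * r := by ring
    have h2 : Eτ ^ 2 * ((‖curlCLM‖ * K) ^ 2 * ((101 / 100) ^ 3 * V₃)) * r = Eτ ^ 2 * K₂ * r := by
      rw [hK₂]
    rw [h1, h2] at hsq
    have h3 : N ^ 2 * r ^ 5 * (V₃ * κ) ^ 2 < Eτ ^ 2 * K₂ := lt_of_mul_lt_mul_right hsq hrpos.le
    exact h3.trans_le (mul_le_mul_of_nonneg_right hEτ hK₂0)
  -- but `‖ω‖_∞² r⁵ = c⁵ = ‖u₀‖₂² K₂ /(V₃ κ)² + 1`: contradiction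
  have hr5 : N ^ 2 * r ^ 5 = c ^ 5 := by
    have h1 : (N ^ (2 / 5 : ℝ)) ^ 5 = N ^ 2 := by
      rw [← Real.rpow_mul_natCast hNpos.le, show (2 / 5 : ℝ) * ((5 : ℕ) : ℝ) = ((2 : ℕ) : ℝ) by
        norm_num, Real.rpow_natCast]
    rw [hr, div_pow, h1]
    field_simp
  have hc5 : c ^ 5 = E₀ ^ 2 * K₂ / (V₃ * κ) ^ 2 + 1 := by
    rw [hc, ← Real.rpow_mul_natCast hbase0, show (1 / 5 : ℝ) * ((5 : ℕ) : ℝ) = 1 by norm_num,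
      Real.rpow_one]
  have hVκ : 0 < (V₃ * κ) ^ 2 := by positivity
  rw [hr5, hc5, add_mul, div_mul_cancel₀ _ hVκ.ne', one_mul] at hsq'
  linarith

end Literature.Analysis.FluidPDE

end
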